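import Literature.Geometry.Lorentzian.KerrCylinderSpinExpansionK
import Literature.Geometry.Lorentzian.SchwarzschildKillingAlgebraProofs

/-!
# Route EIHFluxBalance — `InertialRecession` (E′), K1 / stub `stub_coerMomKernel` (Bk), far field, part F3b:
# the rest-frame Lie derivative of the spin-dipole term along a rotation is the spin-dipole term of the rotated spin

Helper file for the crux `stmt-FinalStateConjecture-17403` (glue between Bk's `Var` built on `Kerr.spinMetric` and the spin
row tables `…SlavingFarFieldSpinRowsA/B`). For the rotation generator `R_ω u⃗ = ω × u⃗` (`R_ω e₀ = 0`) and the first-order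
spin term `σ_M(x)(A,B) = (2M/r³)(ℓ(A)·swirl(B) + swirl(A)·ℓ(B))` (`= Kerr.spinMetric M x`, `spinMetric_zero_eq`; spin axis
`e₃`), the rest-frame first variation `∂_{R_ω x}σ_M + σ_M(R_ω·,·) + σ_M(·,R_ω·)` equals the Lense–Thirring term with spin
vector `e₃ × ω = (−ω₂, ω₁, 0)`, in the closed form used by the spin-row tables (`lie_rotation_spinMetric`); in particular it
vanishes for `ω ∥ e₃` (axisymmetry at dipole order). Pure algebra in the atoms (`Schwarzschild.dSig` is the derivative of
`σ_M`, `fderiv_spinMetric_apply`). No definitions, no `sorry`. [folklore]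
-/

set_option linter.dupNamespace false

noncomputable section

-- instance search through the nested operator types (as in `SchwarzschildKerrSchildComponents`)
set_option maxSynthPendingDepth 3

open scoped Topology InnerProductSpace
open Filter Set Function Literature.Geometry.Lorentzian Literature.Geometry.Lorentzian.Schwarzschild

namespace Summit.FinalStateConjecture.FinalStateConjecture.Theorems.SublinearIsFree.Slaving

variable {x : E4}

/-- `swirl` in coordinates: `swirl x A = x₂A₁ − x₁A₂`. [folklore] -/
theorem swirl_eq (x A : E4) : swirl x A = x 2 * A 1 - x 1 * A 2 := by
  simp [swirl, E4.spatial_apply]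

/-- **Lie derivative of the spin-dipole term along a rotation = spin-dipole term of the rotated spin.** For the rotation
generator `R` with `R u = (0, ω × u⃗)` and `x` off the time axis:
`dSig M x (R x) U W + σ_M(x)(R U, W) + σ_M(x)(U, R W) = (2M/r³)(ℓ(U)⟪x⃗, c(W)⟫ + ⟪x⃗, c(U)⟫ℓ(W))`,
`c(U) = (0, σ × U⃗)` with `σ = (−ω₂, ω₁, 0) = e₃ × ω` (the `hS`-form of `…SlavingFarFieldSpinRowsA/B` with
`(σ₁,σ₂,σ₃) = (−ω₂, ω₁, 0)`). [folklore] -/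
theorem lie_rotation_spinMetric (M : ℝ) (hx : E4.spatial x ≠ 0) (ω₁ ω₂ ω₃ : ℝ) (R : E4 →L[ℝ] E4)
    (hR : ∀ u : E4, R u = ![0, ω₂ * u 3 - ω₃ * u 2, ω₃ * u 1 - ω₁ * u 3, ω₁ * u 2 - ω₂ * u 1]) (U W : E4) :
    dSig M x (R x) U W + Kerr.spinMetric M x (R U) W + Kerr.spinMetric M x U (R W) =
      2 * M / E4.spatialNorm x ^ 3 *
        (ell x U * sdot x (WithLp.toLp 2 ![(0 : ℝ), ω₁ * W 3 - 0 * W 2, 0 * W 1 - -ω₂ * W 3, -ω₂ * W 2 - ω₁ * W 1]) +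
          sdot x (WithLp.toLp 2 ![(0 : ℝ), ω₁ * U 3 - 0 * U 2, 0 * U 1 - -ω₂ * U 3, -ω₂ * U 2 - ω₁ * U 1]) * ell x W) := by
  have hr : E4.spatialNorm x ≠ 0 := by rwa [E4.spatialNorm, norm_ne_zero_iff]
  rw [spinMetric_zero_eq M hx, spinMetric_zero_eq M hx]
  simp only [dSig, ell, dEll, swirl_eq, sdot_eq, hR, Matrix.cons_val_zero, Matrix.cons_val_one,
    Matrix.head_cons, Matrix.cons_val_two, Matrix.tail_cons, Matrix.cons_val_three]
  field_simp
  ring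

/-- **Axisymmetry at dipole order**: for `ω ∥ e₃` the first variation of the spin term along `R_ω` vanishes. [folklore] -/
theorem lie_axialRotation_spinMetric (M : ℝ) (hx : E4.spatial x ≠ 0) (ω₃ : ℝ) (R : E4 →L[ℝ] E4)
    (hR : ∀ u : E4, R u = ![0, 0 * u 3 - ω₃ * u 2, ω₃ * u 1 - 0 * u 3, 0 * u 2 - 0 * u 1]) (U W : E4) :
    dSig M x (R x) U W + Kerr.spinMetric M x (R U) W + Kerr.spinMetric M x U (R W) = 0 := by
  rw [lie_rotation_spinMetric M hx 0 0 ω₃ R hR U W]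
  simp [sdot_eq]

/-- The same first variation with `fderiv` in place of `dSig` (given differentiability of `Kerr.spinMetric M` at `x`).
[folklore] -/
theorem fderiv_rotation_spinMetric (M : ℝ) (hx : E4.spatial x ≠ 0) (hd : DifferentiableAt ℝ (Kerr.spinMetric M) x)
    (ω₁ ω₂ ω₃ : ℝ) (R : E4 →L[ℝ] E4)
    (hR : ∀ u : E4, R u = ![0, ω₂ * u 3 - ω₃ * u 2, ω₃ * u 1 - ω₁ * u 3, ω₁ * u 2 - ω₂ * u 1]) (U W : E4) :
    fderiv ℝ (Kerr.spinMetric M) x (R x) U W + Kerr.spinMetric M x (R U) W + Kerr.spinMetric M x U (R W) =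
      2 * M / E4.spatialNorm x ^ 3 *
        (ell x U * sdot x (WithLp.toLp 2 ![(0 : ℝ), ω₁ * W 3 - 0 * W 2, 0 * W 1 - -ω₂ * W 3, -ω₂ * W 2 - ω₁ * W 1]) +
          sdot x (WithLp.toLp 2 ![(0 : ℝ), ω₁ * U 3 - 0 * U 2, 0 * U 1 - -ω₂ * U 3, -ω₂ * U 2 - ω₁ * U 1]) * ell x W) := by
  rw [fderiv_spinMetric_apply M hx hd]
  exact lie_rotation_spinMetric M hx ω₁ ω₂ ω₃ R hR U W

/-- Registered carrier `slaving_farFieldSpinLie_slaving12` of the crux item (= `swirl_eq`). [folklore] -/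
theorem slaving_farFieldSpinLie_slaving12 : open Literature.Geometry.Lorentzian.Schwarzschild in ∀ x A : E4, swirl x A = x 2 * A 1 - x 1 * A 2 :=
  swirl_eq

end Summit.FinalStateConjecture.FinalStateConjecture.Theorems.SublinearIsFree.Slaving
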